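import Mathlib.Analysis.SpecialFunctions.Trigonometric.Basic
import Mathlib.Analysis.SpecialFunctions.Pow.Real
import Mathlib.Analysis.SpecialFunctions.Sqrt
import Mathlib.Tactic.IntervalCases
import HarnessLib

/-!
# The exposed-area / contact-deficit LP for sticky spheres in `ℝ³`: the summation and its certified constant

Venture `Crystal3D` (cell `pub-crystal3d`, seat p2 = local-inequality decomposition), companion of the cell file
`HOME/ineq/DECOMPOSITION.md` §§3–5.

HONEST FRAMING. This file proves the ARITHMETIC SKELETON of the surface-term bound
`C ≤ 6n − γ n^{2/3}` for the number `C` of touching pairs among `n` unit balls of `ℝ³`: (i) the per-ball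
summation ("LP over ball types `k` = number of contacts": exposed area `≤ f(k)`, deficit `12 − k`), and
(ii) the certified inequalities between the explicit algebraic constants of the Lévy-dilation table at
truncation radius `r̂ = 2` (`α = π/3`, `δ = π/6`), giving `γ ≥ 1.673` relative to a surface lower bound
`4π n^{2/3}`. The GEOMETRIC inputs that produce the exposed areas `e i` and the hypothesis `Σ e i ≥ S`
(kissing number — proved in the tree —, cap disjointness, Lévy's spherical isoperimetric inequality, the
isoperimetric inequality of `ℝ³`, the Voronoi tiling of the union of `r̂`-balls) are NOT formalised here; they
are hypotheses of the final theorem, documented in `DECOMPOSITION.md` §3. Nothing here is a crystallization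
statement.

## The table at `r̂ = 2`
For a ball with `k ∈ {1,…,11}` contacts, the uncovered directions `W ⊂ S²` satisfy, by cap disjointness and Lévy's
inequality, `σ(W) ≤ cap(θ_k − π/6)` with `cos θ_k = c_k := k(1 − √3/2) − 1`, i.e. the exposed area of the sphere
of radius `2` is at most `f(k) := 4 · 2π (1 − cos(θ_k − π/6)) = 8π · g_k`,
`g_k := 1 − (√3/2) c_k − ½ √(1 − c_k²)`; `f(12) = 0` (kissing saturation), and maximisers have no ball with
`k = 0`. The LP constant is `ρ = max_k f(k)/(12−k) = f(11)` (binding type `k = 11`, proved below: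
`g_k ≤ (12 − k) g₁₁` for `1 ≤ k ≤ 10`) and `g₁₁ < 0.14941`, whence `γ = 2π/ρ = 1/(4 g₁₁) > 1.6732`.
-/

noncomputable section

open Real Finset

namespace Summit.Ventures.Crystal3D.Inequalities

/-! ### 1. The summation (one term per ball, unit weights) -/

/-- **The exposed-area / deficit summation.** Balls `i ∈ Fin n` with contact numbers `k i ∈ {1,…,12}` and
exposed areas `e i ≤ f (k i)`, where `f 12 ≤ 0` and `f m ≤ ρ (12 − m)` for `1 ≤ m ≤ 11` (`ρ > 0`); if the total
exposed area is at least `S`, then `Σ k i ≤ 12 n − S/ρ`, i.e. the number of contacts `½ Σ k i` is at most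
`6n − S/(2ρ)`. [折 DECOMPOSITION.md §4 (a)–(c); Bezdek–Reid 2013 §2 architecture] [folklore] -/
theorem sum_deg_le_of_exposed {n : ℕ} (k : Fin n → ℕ) (e : Fin n → ℝ) (f : ℕ → ℝ) {ρ S : ℝ}
    (hρ : 0 < ρ) (hk1 : ∀ i, 1 ≤ k i) (hk12 : ∀ i, k i ≤ 12) (hf12 : f 12 ≤ 0)
    (hf : ∀ m, 1 ≤ m → m ≤ 11 → f m ≤ ρ * (12 - m)) (he : ∀ i, e i ≤ f (k i))
    (hS : S ≤ ∑ i, e i) :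
    (∑ i, (k i : ℝ)) ≤ 12 * n - S / ρ := by
  have key : ∀ i, e i ≤ ρ * (12 - (k i : ℝ)) := by
    intro i
    rcases Nat.lt_or_ge (k i) 12 with hlt | hge
    · have := hf (k i) (hk1 i) (by omega)
      exact (he i).trans (by exact_mod_cast this)
    · have h12 : k i = 12 := le_antisymm (hk12 i) hge
      have : e i ≤ 0 := (he i).trans (by rw [h12]; exact hf12)
      rw [h12]; push_cast; linarith
  have hsum : S ≤ ρ * (12 * n - ∑ i, (k i : ℝ)) := by
    calc S ≤ ∑ i, e i := hS
      _ ≤ ∑ i, ρ * (12 - (k i : ℝ)) := sum_le_sum fun i _ => key i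
      _ = ρ * (12 * n - ∑ i, (k i : ℝ)) := by
        rw [← mul_sum, sum_sub_distrib, sum_const, card_univ, Fintype.card_fin, nsmul_eq_mul]; ring
  have : S / ρ ≤ 12 * n - ∑ i, (k i : ℝ) := by
    rw [div_le_iff₀ hρ]; linarith
  linarith

/-- **Contact form**: with `2 C = Σ k i` (handshake), `C ≤ 6 n − S/(2ρ)`. [folklore] -/
theorem contacts_le_of_exposed {n C : ℕ} (k : Fin n → ℕ) (e : Fin n → ℝ) (f : ℕ → ℝ) {ρ S : ℝ}
    (hρ : 0 < ρ) (hk1 : ∀ i, 1 ≤ k i) (hk12 : ∀ i, k i ≤ 12) (hf12 : f 12 ≤ 0)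
    (hf : ∀ m, 1 ≤ m → m ≤ 11 → f m ≤ ρ * (12 - m)) (he : ∀ i, e i ≤ f (k i))
    (hS : S ≤ ∑ i, e i) (hC : 2 * C = ∑ i, k i) :
    (C : ℝ) ≤ 6 * n - S / (2 * ρ) := by
  have h := sum_deg_le_of_exposed k e f hρ hk1 hk12 hf12 hf he hS
  have hC' : (2 * C : ℝ) = ∑ i, (k i : ℝ) := by exact_mod_cast hC
  have hρ2 : S / (2 * ρ) = (S / ρ) / 2 := by rw [div_div, mul_comm]
  rw [hρ2]
  linarith


/-! ### 2. From Lévy's inequality to the cap-radius bound (the step `F(k)` of DECOMPOSITION.md §3) -/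

/-- `c_k := k (1 − √3/2) − 1`, the cosine of the critical angle `θ_k`: a cap of radius `θ_k` has area
`4π − k · cap(π/6)`. [folklore] -/
def cθ (k : ℕ) : ℝ := k * (1 - sqrt 3 / 2) - 1

/-- `g_k := 1 − (√3/2) c_k − ½ √(1 − c_k²)` (`= 1 − cos(θ_k − π/6)`, see `one_sub_cos_sub_eq_g`). [folklore] -/
def g (k : ℕ) : ℝ := 1 - sqrt 3 / 2 * cθ k - 1 / 2 * sqrt (1 - cθ k ^ 2)

/-- **The Lévy-dilation exposed-area table at truncation radius `r̂ = 2`** (sphere of radius `2`, so areas are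
`4σ`): `f 0 = 16π` (whole sphere), `f k = 8π g_k` for `1 ≤ k ≤ 11`, `f k = 0` for `k ≥ 12` (kissing saturation).
[folklore] -/
def fLevy2 (k : ℕ) : ℝ := if k = 0 then 16 * π else if 12 ≤ k then 0 else 8 * π * g k

/-- **Area bookkeeping of the dilation step.** If the `δ`-neighbourhood of the uncovered set has (by Lévy) area at
least that of a cap of radius `ρ_W + δ ≤ π`, and (by disjointness from the `k` open `π/6`-caps) at most
`4π − k · 2π(1 − √3/2)`, then `c_k ≤ cos(ρ_W + δ)`. [folklore] -/
theorem cθ_le_cos_of_area {k : ℕ} {x : ℝ}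
    (harea : 2 * π * (1 - cos x) ≤ 4 * π - k * (2 * π * (1 - sqrt 3 / 2))) : cθ k ≤ cos x := by
  unfold cθ
  have hπ : 0 < π := pi_pos
  nlinarith

/-- **Monotonicity of `cos` on `[0, π]` read backwards**: `cos θ ≤ cos x` with `x ≤ π`, `0 ≤ θ` gives `x ≤ θ`.
[folklore] -/
theorem le_of_cos_le_cos {x θ : ℝ} (hxπ : x ≤ π) (hθ0 : 0 ≤ θ)
    (h : cos θ ≤ cos x) : x ≤ θ := by
  by_contra hlt
  push Not at hlt
  have := cos_lt_cos_of_nonneg_of_le_pi hθ0 hxπ hlt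
  linarith

/-- **The closed form**: for `θ ∈ [0, π]` with `cos θ = c_k`, `1 − cos(θ − π/6) = g_k`. [folklore] -/
theorem one_sub_cos_sub_eq_g {θ : ℝ} {k : ℕ} (h0 : 0 ≤ θ) (hπ : θ ≤ π) (hc : cos θ = cθ k) :
    1 - cos (θ - π / 6) = g k := by
  have hs : sin θ = sqrt (1 - cθ k ^ 2) := by
    rw [← hc, show 1 - cos θ ^ 2 = sin θ ^ 2 from (sin_sq θ).symm]
    exact (sqrt_sq (sin_nonneg_of_nonneg_of_le_pi h0 hπ)).symm
  unfold g
  rw [cos_sub, cos_pi_div_six, sin_pi_div_six, hc, ← hs]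
  ring

/-- **Cap areas are monotone in the radius on `[0, π]`.** [folklore] -/
theorem cap_area_mono {x y : ℝ} (hx0 : 0 ≤ x) (hxy : x ≤ y) (hyπ : y ≤ π) :
    2 * π * (1 - cos x) ≤ 2 * π * (1 - cos y) := by
  have : cos y ≤ cos x := cos_le_cos_of_nonneg_of_le_pi hx0 hyπ hxy
  have hπ : 0 < π := pi_pos
  nlinarith

/-- **`F(k)` at `r̂ = 2`.** Let `1 ≤ k ≤ 11`, let `θ ∈ [0, π]` with `cos θ = c_k`, and let the uncovered set have
area `4 · 2π(1 − cos ρ_W)` on the sphere of radius `2` (cap radius `ρ_W ≥ 0`) with `ρ_W + π/6 ≤ π` and the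
area bookkeeping hypothesis of `cθ_le_cos_of_area` at `x = ρ_W + π/6`. Then the exposed area is at most
`fLevy2 k = 8π g_k`. [folklore] -/
theorem exposed_le_fLevy2 {k : ℕ} (hk1 : 1 ≤ k) (hk11 : k ≤ 11) {θ ρW : ℝ} (hθ0 : 0 ≤ θ) (hθπ : θ ≤ π)
    (hc : cos θ = cθ k) (hρ0 : 0 ≤ ρW) (hρπ : ρW + π / 6 ≤ π)
    (harea : 2 * π * (1 - cos (ρW + π / 6)) ≤ 4 * π - k * (2 * π * (1 - sqrt 3 / 2))) :
    4 * (2 * π * (1 - cos ρW)) ≤ fLevy2 k := by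
  have hπ : 0 < π := pi_pos
  have h1 : cθ k ≤ cos (ρW + π / 6) := cθ_le_cos_of_area harea
  have h2 : ρW + π / 6 ≤ θ :=
    le_of_cos_le_cos hρπ hθ0 (by rw [hc]; exact h1)
  have h3 : 2 * π * (1 - cos ρW) ≤ 2 * π * (1 - cos (θ - π / 6)) :=
    cap_area_mono hρ0 (by linarith) (by linarith)
  have h4 : 1 - cos (θ - π / 6) = g k := one_sub_cos_sub_eq_g hθ0 hθπ hc
  have hk0 : k ≠ 0 := by omega
  have hk12 : ¬ 12 ≤ k := by omega
  simp only [fLevy2, hk0, hk12, if_false]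
  nlinarith

/-! ### 3. The certified constants (binding type `k = 11`; `γ > 1.6732`) -/

/-- `1.7320508 < √3 < 1.7320509`. [folklore] -/
theorem sqrt_three_bounds : (1.7320508 : ℝ) < sqrt 3 ∧ sqrt 3 < 1.7320509 := by
  constructor
  · rw [lt_sqrt (by norm_num)]; norm_num
  · rw [sqrt_lt' (by norm_num)]; norm_num

/-- `0.149408 < g₁₁ < 0.149409` (`g₁₁ = 0.14940835…`). [folklore] -/
theorem g_eleven_bounds : (0.149408 : ℝ) < g 11 ∧ g 11 < 0.149409 := by
  obtain ⟨h3l, h3u⟩ := sqrt_three_bounds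
  have hcl : (0.47372 : ℝ) < cθ 11 := by unfold cθ; linarith
  have hcu : cθ 11 < (0.4737206 : ℝ) := by unfold cθ; linarith
  have hsl : (0.8806751 : ℝ) < sqrt (1 - cθ 11 ^ 2) := by
    rw [lt_sqrt (by norm_num)]; nlinarith
  have hsu : sqrt (1 - cθ 11 ^ 2) < (0.8806756 : ℝ) := by
    rw [sqrt_lt' (by norm_num)]; nlinarith
  unfold g
  constructor <;> nlinarith

/-- `g_1 ≤ 1.500164642245` (certified bracket; `g_1/(12 − 1) < g₁₁`). [folklore] -/
theorem g_one_le : g 1 ≤ 1.500164642245 := by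
  obtain ⟨h3l, h3u⟩ := sqrt_three_bounds
  have hcl : (-0.8661 : ℝ) < cθ 1 := by unfold cθ; linarith
  have hcu : cθ 1 < (-0.866 : ℝ) := by unfold cθ; linarith
  have hsl : (0.4998 : ℝ) < sqrt (1 - cθ 1 ^ 2) := by
    rw [lt_sqrt (by norm_num)]; nlinarith
  unfold g
  nlinarith

/-- `g_2 ≤ 1.293467231945` (certified bracket; `g_2/(12 − 2) < g₁₁`). [folklore] -/
theorem g_two_le : g 2 ≤ 1.293467231945 := by
  obtain ⟨h3l, h3u⟩ := sqrt_three_bounds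
  have hcl : (-0.7321 : ℝ) < cθ 2 := by unfold cθ; linarith
  have hcu : cθ 2 < (-0.732 : ℝ) := by unfold cθ; linarith
  have hsl : (0.6811 : ℝ) < sqrt (1 - cθ 2 ^ 2) := by
    rw [lt_sqrt (by norm_num)]; nlinarith
  unfold g
  nlinarith

/-- `g_3 ≤ 1.117269821645` (certified bracket; `g_3/(12 − 3) < g₁₁`). [folklore] -/
theorem g_three_le : g 3 ≤ 1.117269821645 := by
  obtain ⟨h3l, h3u⟩ := sqrt_three_bounds
  have hcl : (-0.5981 : ℝ) < cθ 3 := by unfold cθ; linarith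
  have hcu : cθ 3 < (-0.598 : ℝ) := by unfold cθ; linarith
  have hsl : (0.8014 : ℝ) < sqrt (1 - cθ 3 ^ 2) := by
    rw [lt_sqrt (by norm_num)]; nlinarith
  unfold g
  nlinarith

/-- `g_4 ≤ 0.95915901389` (certified bracket; `g_4/(12 − 4) < g₁₁`). [folklore] -/
theorem g_four_le : g 4 ≤ 0.95915901389 := by
  obtain ⟨h3l, h3u⟩ := sqrt_three_bounds
  have hcl : (-0.4642 : ℝ) < cθ 4 := by unfold cθ; linarith
  have hcu : cθ 4 < (-0.4641 : ℝ) := by unfold cθ; linarith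
  have hsl : (0.8857 : ℝ) < sqrt (1 - cθ 4 ^ 2) := by
    rw [lt_sqrt (by norm_num)]; nlinarith
  unfold g
  nlinarith

/-- `g_5 ≤ 0.81401160359` (certified bracket; `g_5/(12 − 5) < g₁₁`). [folklore] -/
theorem g_five_le : g 5 ≤ 0.81401160359 := by
  obtain ⟨h3l, h3u⟩ := sqrt_three_bounds
  have hcl : (-0.3302 : ℝ) < cθ 5 := by unfold cθ; linarith
  have hcu : cθ 5 < (-0.3301 : ℝ) := by unfold cθ; linarith
  have hsl : (0.9439 : ℝ) < sqrt (1 - cθ 5 ^ 2) := by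
    rw [lt_sqrt (by norm_num)]; nlinarith
  unfold g
  nlinarith

/-- `g_6 ≤ 0.67966419329` (certified bracket; `g_6/(12 − 6) < g₁₁`). [folklore] -/
theorem g_six_le : g 6 ≤ 0.67966419329 := by
  obtain ⟨h3l, h3u⟩ := sqrt_three_bounds
  have hcl : (-0.1962 : ℝ) < cθ 6 := by unfold cθ; linarith
  have hcu : cθ 6 < (-0.1961 : ℝ) := by unfold cθ; linarith
  have hsl : (0.9805 : ℝ) < sqrt (1 - cθ 6 ^ 2) := by
    rw [lt_sqrt (by norm_num)]; nlinarith
  unfold g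
  nlinarith

/-- `g_7 ≤ 0.55486678299` (certified bracket; `g_7/(12 − 7) < g₁₁`). [folklore] -/
theorem g_seven_le : g 7 ≤ 0.55486678299 := by
  obtain ⟨h3l, h3u⟩ := sqrt_three_bounds
  have hcl : (-0.0622 : ℝ) < cθ 7 := by unfold cθ; linarith
  have hcu : cθ 7 < (-0.0621 : ℝ) := by unfold cθ; linarith
  have hsl : (0.998 : ℝ) < sqrt (1 - cθ 7 ^ 2) := by
    rw [lt_sqrt (by norm_num)]; nlinarith
  unfold g
  nlinarith

/-- `g_8 ≤ 0.43920597882` (certified bracket; `g_8/(12 − 8) < g₁₁`). [folklore] -/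
theorem g_eight_le : g 8 ≤ 0.43920597882 := by
  obtain ⟨h3l, h3u⟩ := sqrt_three_bounds
  have hcl : (0.0717 : ℝ) < cθ 8 := by unfold cθ; linarith
  have hcu : cθ 8 < (0.0718 : ℝ) := by unfold cθ; linarith
  have hsl : (0.9974 : ℝ) < sqrt (1 - cθ 8 ^ 2) := by
    rw [lt_sqrt (by norm_num)]; nlinarith
  unfold g
  nlinarith

/-- `g_9 ≤ 0.33260857522` (certified bracket; `g_9/(12 − 9) < g₁₁`). [folklore] -/
theorem g_nine_le : g 9 ≤ 0.33260857522 := by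
  obtain ⟨h3l, h3u⟩ := sqrt_three_bounds
  have hcl : (0.2057 : ℝ) < cθ 9 := by unfold cθ; linarith
  have hcu : cθ 9 < (0.2058 : ℝ) := by unfold cθ; linarith
  have hsl : (0.9785 : ℝ) < sqrt (1 - cθ 9 ^ 2) := by
    rw [lt_sqrt (by norm_num)]; nlinarith
  unfold g
  nlinarith

/-- `g_10 ≤ 0.23561117162` (certified bracket; `g_10/(12 − 10) < g₁₁`). [folklore] -/
theorem g_ten_le : g 10 ≤ 0.23561117162 := by
  obtain ⟨h3l, h3u⟩ := sqrt_three_bounds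
  have hcl : (0.3397 : ℝ) < cθ 10 := by unfold cθ; linarith
  have hcu : cθ 10 < (0.3398 : ℝ) := by unfold cθ; linarith
  have hsl : (0.9404 : ℝ) < sqrt (1 - cθ 10 ^ 2) := by
    rw [lt_sqrt (by norm_num)]; nlinarith
  unfold g
  nlinarith

/-- **The binding type is `k = 11`**: `g_k ≤ (12 − k) g₁₁` for `1 ≤ k ≤ 11`. [folklore] -/
theorem g_le_deficit_mul_g_eleven {k : ℕ} (hk1 : 1 ≤ k) (hk11 : k ≤ 11) :
    g k ≤ (12 - (k : ℝ)) * g 11 := by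
  have h11 := g_eleven_bounds.1
  interval_cases k
  · have := g_one_le; push_cast; linarith
  · have := g_two_le; push_cast; linarith
  · have := g_three_le; push_cast; linarith
  · have := g_four_le; push_cast; linarith
  · have := g_five_le; push_cast; linarith
  · have := g_six_le; push_cast; linarith
  · have := g_seven_le; push_cast; linarith
  · have := g_eight_le; push_cast; linarith
  · have := g_nine_le; push_cast; linarith
  · have := g_ten_le; push_cast; linarith
  · push_cast; linarith

/-- `fLevy2 11 = 8π g₁₁ > 0`. [folklore] -/
theorem fLevy2_eleven_pos : 0 < fLevy2 11 := by
  have := g_eleven_bounds.1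
  simp only [fLevy2, show (11:ℕ) ≠ 0 by decide, show ¬ 12 ≤ 11 by decide, if_false]
  positivity

/-- **The LP rows**: `fLevy2 m ≤ fLevy2 11 · (12 − m)` for `1 ≤ m ≤ 11`. [folklore] -/
theorem fLevy2_le (m : ℕ) (hm1 : 1 ≤ m) (hm11 : m ≤ 11) : fLevy2 m ≤ fLevy2 11 * (12 - (m : ℝ)) := by
  have hπ : 0 < π := pi_pos
  have h := g_le_deficit_mul_g_eleven hm1 hm11
  have hm0 : m ≠ 0 := by omega
  have hm12 : ¬ 12 ≤ m := by omega
  simp only [fLevy2, hm0, hm12, show (11:ℕ) ≠ 0 by decide, show ¬ 12 ≤ 11 by decide, if_false]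
  nlinarith

/-- `fLevy2 12 = 0`. [folklore] -/
theorem fLevy2_twelve : fLevy2 12 = 0 := by simp [fLevy2]

/-- **The constant**: `γ = 2π / fLevy2 11 = 1/(4 g₁₁) > 1.6732`. [folklore] -/
theorem gamma_gt : (1.6732 : ℝ) < 2 * π / fLevy2 11 := by
  have hπ : 0 < π := pi_pos
  obtain ⟨h1, h2⟩ := g_eleven_bounds
  have hf : fLevy2 11 = 8 * π * g 11 := by simp [fLevy2]
  rw [hf, lt_div_iff₀ (by positivity)]
  nlinarith

/-! ### 4. The assembled bound (Theorem A skeleton of DECOMPOSITION.md §5) -/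

/-- **Contacts vs. exposed area, Lévy table at `r̂ = 2`.** For `n` balls with contact numbers `k i ∈ {1,…,12}`
(kissing number; maximisers have no isolated ball) and exposed areas `e i ≤ fLevy2 (k i)` of their radius-`2`
spheres, if the total exposed area is at least `s · n^{2/3}` (isoperimetric inequality + cell volume bound give
`s = 4π dv^{-2/3}`), then `C ≤ 6n − (s / (2 fLevy2 11)) n^{2/3}`. [folklore] -/
theorem contacts_le_of_levy2 {n C : ℕ} (k : Fin n → ℕ) (e : Fin n → ℝ) {s : ℝ}
    (hk1 : ∀ i, 1 ≤ k i) (hk12 : ∀ i, k i ≤ 12) (he : ∀ i, e i ≤ fLevy2 (k i))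
    (hS : s * (n : ℝ) ^ ((2 : ℝ) / 3) ≤ ∑ i, e i) (hC : 2 * C = ∑ i, k i) :
    (C : ℝ) ≤ 6 * n - s / (2 * fLevy2 11) * (n : ℝ) ^ ((2 : ℝ) / 3) := by
  have h := contacts_le_of_exposed k e fLevy2 fLevy2_eleven_pos hk1 hk12 (le_of_eq fLevy2_twelve)
    (fun m h1 h11 => fLevy2_le m h1 h11) he hS hC
  have hr : s / (2 * fLevy2 11) * (n : ℝ) ^ ((2 : ℝ) / 3) = s * (n : ℝ) ^ ((2 : ℝ) / 3) / (2 * fLevy2 11) := by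
    ring
  rw [hr]; exact h

/-- **Theorem A, arithmetic form (`dv = 1`, elementary cell bound): `C ≤ 6n − 1.6732 n^{2/3}`** given total
exposed area `≥ 4π n^{2/3}`. [folklore] -/
theorem contacts_le_levyA {n C : ℕ} (k : Fin n → ℕ) (e : Fin n → ℝ)
    (hk1 : ∀ i, 1 ≤ k i) (hk12 : ∀ i, k i ≤ 12) (he : ∀ i, e i ≤ fLevy2 (k i))
    (hS : 4 * π * (n : ℝ) ^ ((2 : ℝ) / 3) ≤ ∑ i, e i) (hC : 2 * C = ∑ i, k i) :
    (C : ℝ) ≤ 6 * n - 1.6732 * (n : ℝ) ^ ((2 : ℝ) / 3) := by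
  have h := contacts_le_of_levy2 k e hk1 hk12 he hS hC
  have hγ := gamma_gt
  have hn : 0 ≤ (n : ℝ) ^ ((2 : ℝ) / 3) := by positivity
  have hf := fLevy2_eleven_pos
  have : 4 * π / (2 * fLevy2 11) = 2 * π / fLevy2 11 := by
    field_simp; ring
  rw [this] at h
  nlinarith

/-- **Theorem B, arithmetic form (dodecahedral cell bound `dv = 0.7547`, `dv^{-2/3} > 1.2063`):
`C ≤ 6n − 2.0183 n^{2/3}`** given total exposed area `≥ 4π · 1.2063 · n^{2/3}`.
(`1.2063³ · 0.7547² < 1` certifies `1.2063 < 0.7547^{-2/3}`.) [folklore] -/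
theorem contacts_le_levyB {n C : ℕ} (k : Fin n → ℕ) (e : Fin n → ℝ)
    (hk1 : ∀ i, 1 ≤ k i) (hk12 : ∀ i, k i ≤ 12) (he : ∀ i, e i ≤ fLevy2 (k i))
    (hS : 4 * π * 1.2063 * (n : ℝ) ^ ((2 : ℝ) / 3) ≤ ∑ i, e i) (hC : 2 * C = ∑ i, k i) :
    (C : ℝ) ≤ 6 * n - 2.0183 * (n : ℝ) ^ ((2 : ℝ) / 3) := by
  have h := contacts_le_of_levy2 k e hk1 hk12 he hS hC
  have hγ := gamma_gt
  have hn : 0 ≤ (n : ℝ) ^ ((2 : ℝ) / 3) := by positivity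
  have hf := fLevy2_eleven_pos
  have : 4 * π * 1.2063 / (2 * fLevy2 11) = 1.2063 * (2 * π / fLevy2 11) := by
    field_simp; ring
  rw [this] at h
  nlinarith

/-- The exponent certificate for Theorem B: `1.2063 < 0.7547^{-2/3}` because `1.2063³ · 0.7547² < 1`. [folklore] -/
theorem dodecahedral_factor : (1.2063 : ℝ) ^ 3 * 0.7547 ^ 2 < 1 := by norm_num

end Summit.Ventures.Crystal3D.Inequalities

end
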